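import Summits.Ventures.AbcSig.Conjectures.LevelRaising32L2Instances
import Summits.Ventures.AbcSig.Levels.N1376
import Summits.Ventures.AbcSig.Levels.N1696
import Summits.Ventures.AbcSig.Levels.N1888
import Summits.Ventures.AbcSig.Levels.N1952
import Summits.Ventures.AbcSig.Levels.N2144
import Summits.Ventures.AbcSig.Levels.N2656
import Summits.Ventures.AbcSig.Levels.N3424
import Summits.Ventures.AbcSig.Levels.N4192
import Summits.Ventures.AbcSig.Levels.N4448
import Summits.Ventures.AbcSig.Levels.N4768
import Summits.Ventures.AbcSig.Levels.N5024
import Summits.Ventures.AbcSig.Levels.N5216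
import Summits.Ventures.AbcSig.Levels.N5344

/-!
# Venture AbcSig — `CONJ_LR32_L2` slices at the CENSUS levels `2⁵ℓ` already settled by the tree's coarse-sieve certificates (part 1: `43 ≤ ℓ ≤ 167`)

HONEST FRAMING. Support file of the computation cell `pub-abcsig`, companion of `Conjectures/LevelRaising32L2Instances.lean`
(p495825: the slice `CONJ_LR32_L2At`, `CONJ_LR32_L2At_of_eliminated`, four in-sample slices). `CONJ_LR32_L2` (p490111) is a
CONJECTURE over the abstract `NewformModel`; nothing here proves it or adds evidence for its content beyond what the level files
already certify. GENERATED MECHANICALLY (HOME/plean/g15/gen15/make_census_slices.py) from the plain level files `Levels/N<32ℓ>.lean`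
that are in the tree: a level qualifies iff its `level<N>_sieve` theorem asks the row predicate `X` for NO orbit at any prime exponent
`n ≥ 17` other than primes in Ribet's level-raising set `R₃₂(ℓ) = {n : n ∣ (ℓ + 1)² − a_ℓ(32a)²}` (which the slice excludes by its
hypothesis `¬ LevelRaise a32 ℓ n`, checked here in the kernel by `decide` at each such `(ℓ, n)`). So every slice below is proved
from the COMPUTED hypothesis `NewformModel.DataComplete` of its level file and NOTHING ELSE, by `CONJ_LR32_L2At_of_eliminated_lr`
(variant of `CONJ_LR32_L2At_of_eliminated` keeping the level-raising hypothesis): at these levels every newform passing the coarse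
[BS04, Lemma 4.2] sieve modulo a prime above `n ≥ 17` does so at a LEVEL-RAISING exponent `n ∈ R₃₂(ℓ)` — the premise of the slice is
never met outside `R₃₂(ℓ)`. Numbers: 13 levels, ℓ ∈ {43, 53, 59, 61, 67, 83, 107, 131, 139, 149, 157, 163, 167}; at 8 of them (ℓ ∈ {43, 59, 61, 83, 107, 131, 139, 167}) the coarse residual sets contain no prime
`≥ 17` at all (vacuous as in the companion file); at the other 5 (ℓ ∈ {53, 67, 149, 157, 163}) the residual primes `≥ 17` are
exactly level-raising primes (the cell's «ghosts of 32a», conjecture clause L1), discharged by the slice's hypothesis. WHAT THIS IS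
NOT: the Kraus-table part of the premise and the `CongruentToFrey` conclusion stay idle in every proof here; census levels whose
residual primes `≥ 17` lie OUTSIDE `R₃₂(ℓ)` (closed in the rows of record by Kraus/M4 or other modules, e.g. `ℓ = 109, 181,
193`; at `(313; 23)` the a0 = `E₁` classes are OPEN in the certificates of record (kmax 40) — see HOME/STRUCTURE.md v3.18
E-LR32-313) are NOT sliceable from the coarse certificates and are absent; levels whose tree
files the generator could not parse (other certificate formats) are absent too (no claim either way). Context: HOME/STRUCTURE.md §6 CONJ-LR32; registered test «E2-LR32-R2» (HOME/lead/PREDICTIONS-ODDHALVES-lead-g14.md l.81–l.83).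
Nothing here is a claim on ABC or any summit.

References: [BS04] M. A. Bennett, C. M. Skinner, Canad. J. Math. 56 (2004) 23–54, Lemma 4.2; [Rib90b] K. Ribet, *Raising the levels of
modular representations*, Progr. Math. 81 (1990) 259–271, Thm 1.
-/

namespace Summit.Ventures.AbcSig.Conjectures

open Summit.Ventures.AbcSig

/-- Variant of `CONJ_LR32_L2At_of_eliminated` that keeps the slice's level-raising hypothesis available to the elimination
callback: if every listed orbit is coarse-eliminated at every prime `n ≥ 17`, `n ≠ ℓ`, OUTSIDE `R₃₂(ℓ)`, the slice holds
(its premise is never met there). -/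
theorem CONJ_LR32_L2At_of_eliminated_lr (M : NewformModel) {ℓ : ℕ} (hℓ : ℓ.Prime) {orbits : List OrbitData}
    (hD : M.DataComplete (2 ^ 5 * ℓ) orbits)
    (hgood : ∀ o ∈ orbits, ∀ e ∈ o.coeffs, e.ell.Prime ∧ e.ell ≠ 2 ∧ ¬ e.ell ∣ 2 ^ 5 * ℓ)
    (helim : ∀ n : ℕ, n.Prime → 17 ≤ n → n ≠ ℓ → ¬ LevelRaise a32 ℓ n → ∀ o ∈ orbits, o.Eliminated bs04Allowed n) :
    CONJ_LR32_L2At M ℓ := by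
  intro n hn h17 hnℓ hLR f κ hκ hA
  obtain ⟨o, ho, hfo⟩ := hD f
  exact absurd (arisesMod_bs04_of_lr32ClassAllowed M hℓ (by omega) f hκ hA)
    (M.not_arisesMod_of_eliminated f o hfo n bs04Allowed (helim n hn h17 hnℓ hLR o ho) (hgood o ho))

/-- **`CONJ_LR32_L2` at `ℓ = 43` (level `1376 = 2⁵·43`) holds in every model whose level-1376 newforms are the 10 certified orbits of
`Levels/N1376.lean`** (computed hypothesis `DataComplete`; vacuous: the coarse residual exponents are all `< 17`). -/
theorem CONJ_LR32_L2At_43 (M : NewformModel) (hD : M.DataComplete 1376 level1376Orbits) : CONJ_LR32_L2At M 43 :=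
  CONJ_LR32_L2At_of_eliminated_lr M (by norm_num) hD level1376_wellformed fun n hn h17 _ _ o ho =>
    ((level1376_sieve n hn (by omega) (fun _ => False)
      (fun h => by simp only [List.mem_cons, List.not_mem_nil, or_false] at h; omega)
      (fun h => by simp only [List.mem_cons, List.not_mem_nil, or_false] at h; omega)
      (fun h => by simp only [List.mem_cons, List.not_mem_nil, or_false] at h; omega)
      (fun h => by simp only [List.mem_cons, List.not_mem_nil, or_false] at h; omega)
      (fun h => by simp only [List.mem_cons, List.not_mem_nil, or_false] at h; omega)
      (fun h => by simp only [List.mem_cons, List.not_mem_nil, or_false] at h; omega)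
      (fun h => by simp only [List.mem_cons, List.not_mem_nil, or_false] at h; omega)
      (fun h => by simp only [List.mem_cons, List.not_mem_nil, or_false] at h; omega) o ho).2).elim id False.elim

/-- **`CONJ_LR32_L2` at `ℓ = 53` (level `1696 = 2⁵·53`) holds in every model whose level-1696 newforms are the 15 certified orbits of
`Levels/N1696.lean`** (computed hypothesis `DataComplete`; the coarse residual primes `≥ 17` are [17] ⊆ `R₃₂(53)` = [2, 5, 17] (level raising, excluded by the slice hypothesis; `decide`)). -/
theorem CONJ_LR32_L2At_53 (M : NewformModel) (hD : M.DataComplete 1696 level1696Orbits) : CONJ_LR32_L2At M 53 :=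
  CONJ_LR32_L2At_of_eliminated_lr M (by norm_num) hD level1696_wellformed fun n hn h17 _ hLR o ho =>
    ((level1696_sieve n hn (by omega) (fun _ => False)
      (fun h => by simp only [List.mem_cons, List.not_mem_nil, or_false] at h; omega)
      (fun h => by simp only [List.mem_cons, List.not_mem_nil, or_false] at h; omega)
      (fun h => by simp only [List.mem_cons, List.not_mem_nil, or_false] at h; omega)
      (fun h => by simp only [List.mem_cons, List.not_mem_nil, or_false] at h; omega)
      (fun h => by simp only [List.mem_cons, List.not_mem_nil, or_false] at h; omega)
      (fun h => by simp only [List.mem_cons, List.not_mem_nil, or_false] at h; omega)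
      (fun h => by simp only [List.mem_cons, List.not_mem_nil, or_false] at h; omega)
      (fun h => by
        simp only [List.mem_cons, List.not_mem_nil, or_false] at h
        rcases h with rfl
        all_goals first | omega | exact hLR (by decide +kernel))
      (fun h => by simp only [List.mem_cons, List.not_mem_nil, or_false] at h; omega) o ho).2).elim id False.elim

/-- **`CONJ_LR32_L2` at `ℓ = 59` (level `1888 = 2⁵·59`) holds in every model whose level-1888 newforms are the 16 certified orbits of
`Levels/N1888.lean`** (computed hypothesis `DataComplete`; vacuous: the coarse residual exponents are all `< 17`). -/
theorem CONJ_LR32_L2At_59 (M : NewformModel) (hD : M.DataComplete 1888 level1888Orbits) : CONJ_LR32_L2At M 59 :=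
  CONJ_LR32_L2At_of_eliminated_lr M (by norm_num) hD level1888_wellformed fun n hn h17 _ _ o ho =>
    ((level1888_sieve n hn (by omega) (fun _ => False)
      (fun h => by simp only [List.mem_cons, List.not_mem_nil, or_false] at h; omega)
      (fun h => by simp only [List.mem_cons, List.not_mem_nil, or_false] at h; omega)
      (fun h => by simp only [List.mem_cons, List.not_mem_nil, or_false] at h; omega)
      (fun h => by simp only [List.mem_cons, List.not_mem_nil, or_false] at h; omega)
      (fun h => by simp only [List.mem_cons, List.not_mem_nil, or_false] at h; omega)
      (fun h => by simp only [List.mem_cons, List.not_mem_nil, or_false] at h; omega) o ho).2).elim id False.elim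

/-- **`CONJ_LR32_L2` at `ℓ = 61` (level `1952 = 2⁵·61`) holds in every model whose level-1952 newforms are the 17 certified orbits of
`Levels/N1952.lean`** (computed hypothesis `DataComplete`; vacuous: the coarse residual exponents are all `< 17`). -/
theorem CONJ_LR32_L2At_61 (M : NewformModel) (hD : M.DataComplete 1952 level1952Orbits) : CONJ_LR32_L2At M 61 :=
  CONJ_LR32_L2At_of_eliminated_lr M (by norm_num) hD level1952_wellformed fun n hn h17 _ _ o ho =>
    ((level1952_sieve n hn (by omega) (fun _ => False)
      (fun h => by simp only [List.mem_cons, List.not_mem_nil, or_false] at h; omega)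
      (fun h => by simp only [List.mem_cons, List.not_mem_nil, or_false] at h; omega)
      (fun h => by simp only [List.mem_cons, List.not_mem_nil, or_false] at h; omega)
      (fun h => by simp only [List.mem_cons, List.not_mem_nil, or_false] at h; omega)
      (fun h => by simp only [List.mem_cons, List.not_mem_nil, or_false] at h; omega)
      (fun h => by simp only [List.mem_cons, List.not_mem_nil, or_false] at h; omega)
      (fun h => by simp only [List.mem_cons, List.not_mem_nil, or_false] at h; omega)
      (fun h => by simp only [List.mem_cons, List.not_mem_nil, or_false] at h; omega)
      (fun h => by simp only [List.mem_cons, List.not_mem_nil, or_false] at h; omega)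
      (fun h => by simp only [List.mem_cons, List.not_mem_nil, or_false] at h; omega)
      (fun h => by simp only [List.mem_cons, List.not_mem_nil, or_false] at h; omega) o ho).2).elim id False.elim

/-- **`CONJ_LR32_L2` at `ℓ = 67` (level `2144 = 2⁵·67`) holds in every model whose level-2144 newforms are the 10 certified orbits of
`Levels/N2144.lean`** (computed hypothesis `DataComplete`; the coarse residual primes `≥ 17` are [17] ⊆ `R₃₂(67)` = [2, 17] (level raising, excluded by the slice hypothesis; `decide`)). -/
theorem CONJ_LR32_L2At_67 (M : NewformModel) (hD : M.DataComplete 2144 level2144Orbits) : CONJ_LR32_L2At M 67 :=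
  CONJ_LR32_L2At_of_eliminated_lr M (by norm_num) hD level2144_wellformed fun n hn h17 _ hLR o ho =>
    ((level2144_sieve n hn (by omega) (fun _ => False)
      (fun h => by simp only [List.mem_cons, List.not_mem_nil, or_false] at h; omega)
      (fun h => by simp only [List.mem_cons, List.not_mem_nil, or_false] at h; omega)
      (fun h => by
        simp only [List.mem_cons, List.not_mem_nil, or_false] at h
        rcases h with rfl
        all_goals first | omega | exact hLR (by decide +kernel))
      (fun h => by
        simp only [List.mem_cons, List.not_mem_nil, or_false] at h
        rcases h with rfl
        all_goals first | omega | exact hLR (by decide +kernel)) o ho).2).elim id False.elim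

/-- **`CONJ_LR32_L2` at `ℓ = 83` (level `2656 = 2⁵·83`) holds in every model whose level-2656 newforms are the 20 certified orbits of
`Levels/N2656.lean`** (computed hypothesis `DataComplete`; vacuous: the coarse residual exponents are all `< 17`). -/
theorem CONJ_LR32_L2At_83 (M : NewformModel) (hD : M.DataComplete 2656 level2656Orbits) : CONJ_LR32_L2At M 83 :=
  CONJ_LR32_L2At_of_eliminated_lr M (by norm_num) hD level2656_wellformed fun n hn h17 _ _ o ho =>
    ((level2656_sieve n hn (by omega) (fun _ => False)
      (fun h => by simp only [List.mem_cons, List.not_mem_nil, or_false] at h; omega)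
      (fun h => by simp only [List.mem_cons, List.not_mem_nil, or_false] at h; omega)
      (fun h => by simp only [List.mem_cons, List.not_mem_nil, or_false] at h; omega)
      (fun h => by simp only [List.mem_cons, List.not_mem_nil, or_false] at h; omega) o ho).2).elim id False.elim

/-- **`CONJ_LR32_L2` at `ℓ = 107` (level `3424 = 2⁵·107`) holds in every model whose level-3424 newforms are the 16 certified orbits of
`Levels/N3424.lean`** (computed hypothesis `DataComplete`; vacuous: the coarse residual exponents are all `< 17`). -/
theorem CONJ_LR32_L2At_107 (M : NewformModel) (hD : M.DataComplete 3424 level3424Orbits) : CONJ_LR32_L2At M 107 :=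
  CONJ_LR32_L2At_of_eliminated_lr M (by norm_num) hD level3424_wellformed fun n hn h17 _ _ o ho =>
    ((level3424_sieve n hn (by omega) (fun _ => False)
      (fun h => by simp only [List.mem_cons, List.not_mem_nil, or_false] at h; omega)
      (fun h => by simp only [List.mem_cons, List.not_mem_nil, or_false] at h; omega)
      (fun h => by simp only [List.mem_cons, List.not_mem_nil, or_false] at h; omega)
      (fun h => by simp only [List.mem_cons, List.not_mem_nil, or_false] at h; omega)
      (fun h => by simp only [List.mem_cons, List.not_mem_nil, or_false] at h; omega)
      (fun h => by simp only [List.mem_cons, List.not_mem_nil, or_false] at h; omega)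
      (fun h => by simp only [List.mem_cons, List.not_mem_nil, or_false] at h; omega)
      (fun h => by simp only [List.mem_cons, List.not_mem_nil, or_false] at h; omega) o ho).2).elim id False.elim

/-- **`CONJ_LR32_L2` at `ℓ = 131` (level `4192 = 2⁵·131`) holds in every model whose level-4192 newforms are the 18 certified orbits of
`Levels/N4192.lean`** (computed hypothesis `DataComplete`; vacuous: the coarse residual exponents are all `< 17`). -/
theorem CONJ_LR32_L2At_131 (M : NewformModel) (hD : M.DataComplete 4192 level4192Orbits) : CONJ_LR32_L2At M 131 :=
  CONJ_LR32_L2At_of_eliminated_lr M (by norm_num) hD level4192_wellformed fun n hn h17 _ _ o ho =>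
    ((level4192_sieve n hn (by omega) (fun _ => False)
      (fun h => by simp only [List.mem_cons, List.not_mem_nil, or_false] at h; omega)
      (fun h => by simp only [List.mem_cons, List.not_mem_nil, or_false] at h; omega)
      (fun h => by simp only [List.mem_cons, List.not_mem_nil, or_false] at h; omega)
      (fun h => by simp only [List.mem_cons, List.not_mem_nil, or_false] at h; omega)
      (fun h => by simp only [List.mem_cons, List.not_mem_nil, or_false] at h; omega)
      (fun h => by simp only [List.mem_cons, List.not_mem_nil, or_false] at h; omega)
      (fun h => by simp only [List.mem_cons, List.not_mem_nil, or_false] at h; omega)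
      (fun h => by simp only [List.mem_cons, List.not_mem_nil, or_false] at h; omega) o ho).2).elim id False.elim

/-- **`CONJ_LR32_L2` at `ℓ = 139` (level `4448 = 2⁵·139`) holds in every model whose level-4448 newforms are the 10 certified orbits of
`Levels/N4448.lean`** (computed hypothesis `DataComplete`; vacuous: the coarse residual exponents are all `< 17`). -/
theorem CONJ_LR32_L2At_139 (M : NewformModel) (hD : M.DataComplete 4448 level4448Orbits) : CONJ_LR32_L2At M 139 :=
  CONJ_LR32_L2At_of_eliminated_lr M (by norm_num) hD level4448_wellformed fun n hn h17 _ _ o ho =>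
    ((level4448_sieve n hn (by omega) (fun _ => False)
      (fun h => by simp only [List.mem_cons, List.not_mem_nil, or_false] at h; omega)
      (fun h => by simp only [List.mem_cons, List.not_mem_nil, or_false] at h; omega)
      (fun h => by simp only [List.mem_cons, List.not_mem_nil, or_false] at h; omega)
      (fun h => by simp only [List.mem_cons, List.not_mem_nil, or_false] at h; omega) o ho).2).elim id False.elim

/-- **`CONJ_LR32_L2` at `ℓ = 149` (level `4768 = 2⁵·149`) holds in every model whose level-4768 newforms are the 11 certified orbits of
`Levels/N4768.lean`** (computed hypothesis `DataComplete`; the coarse residual primes `≥ 17` are [17, 41] ⊆ `R₃₂(149)` = [2, 17, 41] (level raising, excluded by the slice hypothesis; `decide`)). -/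
theorem CONJ_LR32_L2At_149 (M : NewformModel) (hD : M.DataComplete 4768 level4768Orbits) : CONJ_LR32_L2At M 149 :=
  CONJ_LR32_L2At_of_eliminated_lr M (by norm_num) hD level4768_wellformed fun n hn h17 _ hLR o ho =>
    ((level4768_sieve n hn (by omega) (fun _ => False)
      (fun h => by simp only [List.mem_cons, List.not_mem_nil, or_false] at h; omega)
      (fun h => by simp only [List.mem_cons, List.not_mem_nil, or_false] at h; omega)
      (fun h => by
        simp only [List.mem_cons, List.not_mem_nil, or_false] at h
        rcases h with rfl
        all_goals first | omega | exact hLR (by decide +kernel))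
      (fun h => by
        simp only [List.mem_cons, List.not_mem_nil, or_false] at h
        rcases h with rfl | rfl
        all_goals first | omega | exact hLR (by decide +kernel))
      (fun h => by simp only [List.mem_cons, List.not_mem_nil, or_false] at h; omega)
      (fun h => by simp only [List.mem_cons, List.not_mem_nil, or_false] at h; omega) o ho).2).elim id False.elim

/-- **`CONJ_LR32_L2` at `ℓ = 157` (level `5024 = 2⁵·157`) holds in every model whose level-5024 newforms are the 10 certified orbits of
`Levels/N5024.lean`** (computed hypothesis `DataComplete`; the coarse residual primes `≥ 17` are [17] ⊆ `R₃₂(157)` = [2, 3, 5, 17] (level raising, excluded by the slice hypothesis; `decide`)). -/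
theorem CONJ_LR32_L2At_157 (M : NewformModel) (hD : M.DataComplete 5024 level5024Orbits) : CONJ_LR32_L2At M 157 :=
  CONJ_LR32_L2At_of_eliminated_lr M (by norm_num) hD level5024_wellformed fun n hn h17 _ hLR o ho =>
    ((level5024_sieve n hn (by omega) (fun _ => False)
      (fun h => by simp only [List.mem_cons, List.not_mem_nil, or_false] at h; omega)
      (fun h => by simp only [List.mem_cons, List.not_mem_nil, or_false] at h; omega)
      (fun h => by
        simp only [List.mem_cons, List.not_mem_nil, or_false] at h
        rcases h with rfl
        all_goals first | omega | exact hLR (by decide +kernel)) o ho).2).elim id False.elim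

/-- **`CONJ_LR32_L2` at `ℓ = 163` (level `5216 = 2⁵·163`) holds in every model whose level-5216 newforms are the listed certified orbits of
`Levels/N5216.lean`** (computed hypothesis `DataComplete`; the coarse residual primes `≥ 17` are [41] ⊆ `R₃₂(163)` = [2, 41] (level raising, excluded by the slice hypothesis; `decide`)). -/
theorem CONJ_LR32_L2At_163 (M : NewformModel) (hD : M.DataComplete 5216 level5216Orbits) : CONJ_LR32_L2At M 163 :=
  CONJ_LR32_L2At_of_eliminated_lr M (by norm_num) hD level5216_wellformed fun n hn h17 _ hLR o ho =>
    ((level5216_sieve n hn (by omega) (fun _ => False)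
      (fun h => by simp only [List.mem_cons, List.not_mem_nil, or_false] at h; omega)
      (fun h => by simp only [List.mem_cons, List.not_mem_nil, or_false] at h; omega)
      (fun h => by
        simp only [List.mem_cons, List.not_mem_nil, or_false] at h
        rcases h with rfl
        all_goals first | omega | exact hLR (by decide +kernel))
      (fun h => by
        simp only [List.mem_cons, List.not_mem_nil, or_false] at h
        rcases h with rfl
        all_goals first | omega | exact hLR (by decide +kernel))
      (fun h => by simp only [List.mem_cons, List.not_mem_nil, or_false] at h; omega)
      (fun h => by simp only [List.mem_cons, List.not_mem_nil, or_false] at h; omega)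
      (fun h => by simp only [List.mem_cons, List.not_mem_nil, or_false] at h; omega)
      (fun h => by simp only [List.mem_cons, List.not_mem_nil, or_false] at h; omega) o ho).2).elim id False.elim

/-- **`CONJ_LR32_L2` at `ℓ = 167` (level `5344 = 2⁵·167`) holds in every model whose level-5344 newforms are the listed certified orbits of
`Levels/N5344.lean`** (computed hypothesis `DataComplete`; vacuous: the coarse residual exponents are all `< 17`). -/
theorem CONJ_LR32_L2At_167 (M : NewformModel) (hD : M.DataComplete 5344 level5344Orbits) : CONJ_LR32_L2At M 167 :=
  CONJ_LR32_L2At_of_eliminated_lr M (by norm_num) hD level5344_wellformed fun n hn h17 _ _ o ho =>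
    ((level5344_sieve n hn (by omega) (fun _ => False)
      (fun h => by simp only [List.mem_cons, List.not_mem_nil, or_false] at h; omega)
      (fun h => by simp only [List.mem_cons, List.not_mem_nil, or_false] at h; omega)
      (fun h => by simp only [List.mem_cons, List.not_mem_nil, or_false] at h; omega)
      (fun h => by simp only [List.mem_cons, List.not_mem_nil, or_false] at h; omega) o ho).2).elim id False.elim

end Summit.Ventures.AbcSig.Conjectures
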